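import Summits.QuantumFields.YangMills.Theorems.BalabanLadderUVSeamRecFloorsCEngine
import HarnessLib

/-!
# Crux `UVSeamRec` (stmt-QuantumFields-20043), registered stub `stub_floorsEngine` (skeleton v3, 26c25409080ac510) from NT's femto line

Helper file (`--supports stmt-QuantumFields-20043`) of the lead prover (unit `ym-spine-20043-p1`).  The v3 line of record
(owner ym-beyond-p2 g19) replaced `stub_floors` by `stub_floorsEngine` = the `heng` binder of the landed
`UnitTransfer.stubFloors_of_engine`: ONE lattice representation of `SU(2)`, an engine unit `a` with `a β / uRec β → c₀ > 0`,
and compact-witness `Q2`/`Q3` floors at unit `a`.  This file types the SUPPLIER side by name: the femto packages of crux NT's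
registered skeleton (19353: `stub_ntfemto : NTFemto` = `∃ r a, TwoPointPinned ∧ Skewness`, `stub_fcp6 : Statement.stub_fcp6`)
at `G = SU(2)`, together with the asymptotic scaling of their unit, give `stub_floorsEngine`'s statement verbatim
(`stubFloorsEngine_of_femto`; generic-`G` form `floorsEngine_of_femto`).  Mechanism: `FloorsC.floorsC_of_femto6`
(`stub_fcp6 ⇒ FBL6 ∧ FC2 ∧ FC3 ⇒` compact-witness floors by the re-run `stub_lower`).  So once NT's femto line lands at
`SU(2)` with a two-loop-commensurate unit, `stub_floorsEngine` closes by `exact stubFloorsEngine_of_femto hSU2 stub_fcp6 ⟨…⟩`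
(`hSU2` from `SimpleTransport.isCompactSimpleLieGroup_su2_of_equiv hcl.some hG` inside `UVSeamRec_of`, or carried).
-/

set_option autoImplicit false

noncomputable section

open scoped SchwartzMap
open MeasureTheory Filter Topology
open Literature.MathematicalPhysics.QuantumFieldTheory Literature.MathematicalPhysics.QuantumLattice
open Summit.QuantumFields.YangMills.Cruxes.OSLegsFromFemtoAndGap.DlrCollarTransfer

namespace Summit.QuantumFields.YangMills.Cruxes.UVSeamRec.FloorsC

variable {G : Type} [Group G] [TopologicalSpace G] [IsTopologicalGroup G] [CompactSpace G]
  [MeasurableSpace G] [BorelSpace G]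

/-- **Engine floors from the femto packages** (generic `G`): `IsCompactSimpleLieGroup G`, `Statement.stub_fcp6`, and ONE
representation with `TwoPointPinned ∧ Skewness` at a unit `a` with `a β / u β → c₀ > 0` give the engine-floors package at
unit `a` relative to `u` (positivity of `a` is a clause of `TwoPointPinned`). [folklore] -/
theorem floorsEngine_of_femto (hG : IsCompactSimpleLieGroup G) (hfcp : Statement.stub_fcp6) (u : ℝ → ℝ)
    (heng : ∃ (r : LatticeRep G) (a : ℝ → ℝ) (c₀ : ℝ), 0 < c₀ ∧
      Tendsto (fun β => a β / u β) atTop (𝓝 c₀) ∧ TwoPointPinned G r a ∧ Skewness G r a) :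
    ∃ (r : LatticeRep G) (a : ℝ → ℝ) (c₀ : ℝ), 0 < c₀ ∧ (∀ β, 0 < a β) ∧
      Tendsto (fun β => a β / u β) atTop (𝓝 c₀) ∧
      (∃ (v : 𝓢(EuclideanSpace ℝ (Fin 4), ℝ)) (ε β₅ Λ₅ : ℝ),
        HasCompactSupport (v : EuclideanSpace ℝ (Fin 4) → ℝ) ∧
        tsupport (v : EuclideanSpace ℝ (Fin 4) → ℝ) ⊆ {y : EuclideanSpace ℝ (Fin 4) | 0 < y 0} ∧ 0 < ε ∧
        ∀ β : ℝ, β₅ ≤ β → ∀ L : ℕ, Λ₅ ≤ a β * L → ε ≤ Q2 G r β L (a β) (thetaTest 4 v) v) ∧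
      (∃ (f g h : 𝓢(EuclideanSpace ℝ (Fin 4), ℝ)) (ε β₅ Λ₅ : ℝ),
        HasCompactSupport (f : EuclideanSpace ℝ (Fin 4) → ℝ) ∧
        HasCompactSupport (g : EuclideanSpace ℝ (Fin 4) → ℝ) ∧
        HasCompactSupport (h : EuclideanSpace ℝ (Fin 4) → ℝ) ∧
        Disjoint (tsupport (f : EuclideanSpace ℝ (Fin 4) → ℝ)) (tsupport (g : EuclideanSpace ℝ (Fin 4) → ℝ)) ∧
        Disjoint (tsupport (g : EuclideanSpace ℝ (Fin 4) → ℝ)) (tsupport (h : EuclideanSpace ℝ (Fin 4) → ℝ)) ∧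
        Disjoint (tsupport (f : EuclideanSpace ℝ (Fin 4) → ℝ)) (tsupport (h : EuclideanSpace ℝ (Fin 4) → ℝ)) ∧
        0 < ε ∧ ∀ β : ℝ, β₅ ≤ β → ∀ L : ℕ, Λ₅ ≤ a β * L → ε ≤ |Q3 G r β L (a β) f g h|) := by
  obtain ⟨r, a, c₀, hc₀, hau, hTP, hSk⟩ := heng
  have hpos : ∀ β, 0 < a β := by
    obtain ⟨Γ, β₀, ℓ₀, c, C, -, -, hpos, -, -⟩ := hTP
    exact hpos
  obtain ⟨h2, h3⟩ := floorsC_of_femto6 G r a hG hfcp hTP hSk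
  exact ⟨r, a, c₀, hc₀, hpos, hau, h2, h3⟩

/-- **The registered stub `stub_floorsEngine` (v3) from NT's femto line at `SU(2)`**: `IsCompactSimpleLieGroup SU(2)`,
`Statement.stub_fcp6`, and ONE lattice representation of `SU(2)` with the femto packages `TwoPointPinned ∧ Skewness` at a unit
`a` with `a β / uRec β → c₀ > 0` give the statement of `stub_floorsEngine` verbatim (with `uRec = Transport.uRec`, defeq to
the skeleton's local abbreviation). [folklore] -/
theorem stubFloorsEngine_of_femto (hSU2 : IsCompactSimpleLieGroup (Matrix.specialUnitaryGroup (Fin 2) ℂ))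
    (hfcp : Statement.stub_fcp6)
    (heng : letI : MeasurableSpace (Matrix.specialUnitaryGroup (Fin 2) ℂ) := borel _
      haveI : BorelSpace (Matrix.specialUnitaryGroup (Fin 2) ℂ) := ⟨rfl⟩
      ∃ (r : LatticeRep (Matrix.specialUnitaryGroup (Fin 2) ℂ)) (a : ℝ → ℝ) (c₀ : ℝ), 0 < c₀ ∧
        Tendsto (fun β => a β / Transport.uRec β) atTop (𝓝 c₀) ∧
        TwoPointPinned (Matrix.specialUnitaryGroup (Fin 2) ℂ) r a ∧ Skewness (Matrix.specialUnitaryGroup (Fin 2) ℂ) r a) :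
    letI : MeasurableSpace (Matrix.specialUnitaryGroup (Fin 2) ℂ) := borel _
    haveI : BorelSpace (Matrix.specialUnitaryGroup (Fin 2) ℂ) := ⟨rfl⟩
    ∃ (r : LatticeRep (Matrix.specialUnitaryGroup (Fin 2) ℂ)) (a : ℝ → ℝ) (c₀ : ℝ), 0 < c₀ ∧ (∀ β, 0 < a β) ∧
      Tendsto (fun β => a β / Transport.uRec β) atTop (𝓝 c₀) ∧
      (∃ (v : 𝓢(EuclideanSpace ℝ (Fin 4), ℝ)) (ε β₅ Λ₅ : ℝ),
        HasCompactSupport (v : EuclideanSpace ℝ (Fin 4) → ℝ) ∧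
        tsupport (v : EuclideanSpace ℝ (Fin 4) → ℝ) ⊆ {y : EuclideanSpace ℝ (Fin 4) | 0 < y 0} ∧ 0 < ε ∧
        ∀ β : ℝ, β₅ ≤ β → ∀ L : ℕ, Λ₅ ≤ a β * L →
          ε ≤ Q2 (Matrix.specialUnitaryGroup (Fin 2) ℂ) r β L (a β) (thetaTest 4 v) v) ∧
      (∃ (f g h : 𝓢(EuclideanSpace ℝ (Fin 4), ℝ)) (ε β₅ Λ₅ : ℝ),
        HasCompactSupport (f : EuclideanSpace ℝ (Fin 4) → ℝ) ∧
        HasCompactSupport (g : EuclideanSpace ℝ (Fin 4) → ℝ) ∧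
        HasCompactSupport (h : EuclideanSpace ℝ (Fin 4) → ℝ) ∧
        Disjoint (tsupport (f : EuclideanSpace ℝ (Fin 4) → ℝ)) (tsupport (g : EuclideanSpace ℝ (Fin 4) → ℝ)) ∧
        Disjoint (tsupport (g : EuclideanSpace ℝ (Fin 4) → ℝ)) (tsupport (h : EuclideanSpace ℝ (Fin 4) → ℝ)) ∧
        Disjoint (tsupport (f : EuclideanSpace ℝ (Fin 4) → ℝ)) (tsupport (h : EuclideanSpace ℝ (Fin 4) → ℝ)) ∧
        0 < ε ∧ ∀ β : ℝ, β₅ ≤ β → ∀ L : ℕ, Λ₅ ≤ a β * L →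
          ε ≤ |Q3 (Matrix.specialUnitaryGroup (Fin 2) ℂ) r β L (a β) f g h|) := by
  letI : MeasurableSpace (Matrix.specialUnitaryGroup (Fin 2) ℂ) := borel _
  haveI : BorelSpace (Matrix.specialUnitaryGroup (Fin 2) ℂ) := ⟨rfl⟩
  exact floorsEngine_of_femto hSU2 hfcp Transport.uRec heng

end Summit.QuantumFields.YangMills.Cruxes.UVSeamRec.FloorsC

end
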